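import Literature.NumberTheory.GaloisCohomology.LocalInvariantMapEvaluation
import Literature.NumberTheory.GaloisRepresentations.BrauerCyclicLayer
import Literature.NumberTheory.GaloisRepresentations.GaloisCohomologyProofs
import Literature.AnabelianGeometry.AbsoluteAnabelian.AbsAnabProp121viiCupCyclicClass
import HarnessLib

/-!
# A class of `H²(Γ_K, μₙ)` dying on `Gal(K̄/L)`, `L/K` cyclic, is a cyclic class `κₙ(b) ∪ ψ`
# (Serre, *Corps locaux* VII §6 Prop. 5, VIII §4, XIV §1 Prop. 2; `Br(L/K) = Kˣ/N Lˣ`)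

Let `K` be a field of characteristic `0`, `n ≥ 1`, `ψ : Γ_K ↠ ℤ/n` a cyclic character with kernel
`Gal(K̄/L)` for a finite `L ⊆ K̄`, and `c ∈ H²(Γ_K, μₙ)`.  If the Brauer class of `c` (its image under
`H²(μₙ) → H²(K̄ˣ)`, the Kummer map) restricts to `0` on `Gal(K̄/L)`, then

  `c = κₙ(b) ∪ ψ`  for some `b ∈ Kˣ`                 (`exists_eq_cupProduct_δ₀_of_resH_eq_zero`),

the cup product of the Kummer class of `b` with the crossed homomorphism `σ ↦ (ψ σ)·id ∈ μₙ^∨(1)`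
(`Prop121vii.scalarCocycle`).  Proof: `ker(Br K → Br L) = κ_ψ(Kˣ)` (the tree's
`exists_cyclicClass_eq_of_res_eq_zero`, Serre VII §6 Prop. 5 + VIII §4, with Hilbert 90 for
`Gal(K̄/L)`, `subsingleton_one_units_galFixing`, and `H⁰(Γ_K, K̄ˣ) = Kˣ`,
`exists_units_map_algebraMap_eq`); `Kummer(κₙ(b) ∪ ψ) = −κ_ψ(b)` (the cochain identity
`Prop121vii.cohomologyMap_kummerι_cupProduct_δ₀_scalar`, Serre XIV §1 Prop. 2); and the Kummer map
is injective (`cohomologyMap_kummerι_two_injective`, Hilbert 90 for `Γ_K`).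

This is the "surjectivity" step of the tree's discharge of `poitouTate_sum_localTatePairing_eq_zero`:
a class killed by a cyclic layer is a cyclic class, to which the sum formula
`sum_localInvariantMap_localization_cupProduct_δ₀_eq_zero` (`BrauerSumInvCyclicClass.lean`) applies.
Proof file: theorems only, no named fact, no instance (D-0026).

## References

* J.-P. Serre, *Corps locaux* / *Local Fields* (1979), VII §6 Prop. 5, VIII §4, X §1 Prop. 2,
  XIV §1 Prop. 2. [SerreLocalFields1979]
* J. W. S. Cassels, A. Fröhlich (eds.), *Algebraic Number Theory* (1967), Ch. VII (Tate) §10.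
  [CasselsFrohlichANT1967]

## Tree search

`lean search 'exists_eq_cupProduct_δ₀|kummerι_two_injective'`: no prior declaration
(`Prop121vii.kummerTwoOntoTorsion_holds` is the local-field case of the injectivity).
-/

noncomputable section

open CategoryTheory Function Field
open scoped NumberField

universe u

namespace Literature.NumberTheory.GaloisCohomology

open _root_.ContinuousCohomology
open Literature.NumberTheory.GaloisRepresentations
open Literature.NumberTheory.GaloisRepresentations.DiscreteGaloisModule
open Literature.NumberTheory.GaloisRepresentations.LocalWeilDatum
open Literature.AnabelianGeometry.AbsoluteAnabelian
open Literature.AnabelianGeometry.AbsoluteAnabelian.Prop121vii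

variable (K : Type u) [Field K] {n : ℕ} [NeZero n]

/-- **The Kummer map `H²(Γ_K, μₙ) → H²(Γ_K, K̄ˣ) = Br(K)` is injective** for every field `K`
(long exact sequence of `1 → μₙ → K̄ˣ → K̄ˣ → 1` and Hilbert 90 `H¹(Γ_K, K̄ˣ) = 0`, tree
`subsingleton_galoisCohomology_units_one_holds`).  [cite: SerreLocalFields1979, X §1 Prop. 2] -/
theorem cohomologyMap_kummerι_two_injective :
    haveI : CompactSpace (absoluteGaloisGroup K) := absoluteGaloisGroup_compactSpace K
    Injective (cohomologyMap (kummerι K n) 2) := by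
  haveI : CompactSpace (absoluteGaloisGroup K) := absoluteGaloisGroup_compactSpace K
  have h := isSES_kummer K n (NeZero.pos n)
  have h90 : Subsingleton (continuousCohomology 1 (units K).toTopRep) :=
    subsingleton_galoisCohomology_units_one_holds K
  refine (injective_iff_map_eq_zero _).2 fun z hz => ?_
  obtain ⟨x, rfl⟩ := h.exists_δ₁_eq_of_map_two_eq_zero z hz
  rw [Subsingleton.elim x 0, map_zero]

variable {K}

/-- `baseUnitsInvariant K x⁻¹ = - baseUnitsInvariant K x`. [cite: SerreGaloisCohomology1997, II §1.2] -/
theorem baseUnitsInvariant_inv (x : K) (hx : x ≠ 0) :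
    baseUnitsInvariant K x⁻¹ (inv_ne_zero hx) = -baseUnitsInvariant K x hx := by
  have h := baseUnitsInvariant_zpow K x hx (-1)
  rw [neg_one_zsmul] at h
  rw [← h]
  congr 1
  exact (zpow_neg_one x).symm

variable [CharZero K]

/-- **A class of `H²(Γ_K, μₙ)` whose Brauer class dies on `Gal(K̄/L)`, `L/K` cyclic cut out by
`ψ : Γ_K ↠ ℤ/n`, is the cyclic class `κₙ(b) ∪ ψ` of some `b ∈ Kˣ`** (Serre VII §6 Prop. 5 with
VIII §4: `ker(Br K → Br L) = H²(G(L/K), Lˣ) ≅ Kˣ/N Lˣ`, its elements are the `(ψ, b)`; XIV §1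
Prop. 2: `(ψ, b) = b ∪ δψ`, which is `−Kummer(κₙ(b) ∪ ψ)` by the tree's cochain identity; and
injectivity of the Kummer map). [cite: SerreLocalFields1979, VII §6 Prop. 5, VIII §4, XIV §1 Prop. 2]
[cite: CasselsFrohlichANT1967, Ch. VII §10] -/
theorem exists_eq_cupProduct_δ₀_of_resH_eq_zero (ψ : CyclicCharacter (absoluteGaloisGroup K) n)
    (L : IntermediateField K (AlgebraicClosure K)) [FiniteDimensional K L] (hker : ψ.ker = galFixing K L)
    (c : galoisCohomology (mu K n) 2)
    (hres : haveI : CompactSpace (absoluteGaloisGroup K) := absoluteGaloisGroup_compactSpace K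
      resH ψ.ker (units K) 2 ((cohomologyMap (kummerι K n) 2).hom c) = 0) :
    ∃ b : Kˣ, haveI : CompactSpace (absoluteGaloisGroup K) := absoluteGaloisGroup_compactSpace K
      c = ((mu K n).tateDualPairing n).cupProduct
        ((isSES_kummer K n (NeZero.pos n)).δ₀ (baseUnitsInvariant K (b : K) b.ne_zero))
        (oneCocycleClass _ (scalarCocycle ψ)) := by
  classical
  haveI : CompactSpace (absoluteGaloisGroup K) := absoluteGaloisGroup_compactSpace K
  rcases Nat.lt_or_ge 1 n with hn1 | hn1
  swap
  · -- `n = 1`: `μ₁ = 0`, so `H²(Γ_K, μ₁) = 0`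
    have hn : n = 1 := le_antisymm hn1 (NeZero.pos n)
    subst hn
    haveI : Subsingleton (MuCarrier K 1) := by
      haveI : Fintype (MuCarrier K 1) := Fintype.ofFinite _
      rw [← Fintype.card_le_one_iff_subsingleton, ← Nat.card_eq_fintype_card, natCard_muCarrier]
    haveI : Subsingleton ((mu K 1).toTopRep) := this
    have hsub := subsingleton_continuousCohomology_of_subsingleton (mu K 1).toTopRep 1
    exact ⟨1, hsub.elim _ _⟩
  haveI : Fact (1 < n) := ⟨hn1⟩
  -- `Kummer c = κ_ψ(a)` for an invariant `a ∈ (K̄ˣ)^{Γ_K}`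
  have hT : Subsingleton (continuousCohomology 1 (((units K).restrict (subgroupIncl ψ.ker)).toTopRep)) := by
    rw [hker]; exact subsingleton_one_units_galFixing _
  obtain ⟨a, ha⟩ := exists_cyclicClass_eq_of_res_eq_zero ψ (units K) hT _ hres
  -- `a` comes from `a₀ ∈ Kˣ`
  have hainv : ∀ σ : absoluteGaloisGroup K, σ • unitsVal K (a : UnitsCarrier K) = unitsVal K (a : UnitsCarrier K) :=
    fun σ => by rw [← unitsVal_apply]; exact congrArg _ (a.2 σ)
  obtain ⟨a₀, ha₀⟩ := exists_units_map_algebraMap_eq K _ hainv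
  have hbase : baseUnitsInvariant K (a₀ : K) a₀.ne_zero = a := by
    apply Subtype.ext
    apply unitsVal_injective K
    refine Units.ext ?_
    rw [coe_unitsVal_baseUnitsInvariant, ← ha₀, Units.coe_map, MonoidHom.coe_coe]
  -- the class `κₙ(a₀⁻¹) ∪ ψ` has the same Brauer class
  refine ⟨a₀⁻¹, cohomologyMap_kummerι_two_injective K ?_⟩
  change (cohomologyMap (kummerι K n) 2).hom c = (cohomologyMap (kummerι K n) 2).hom _
  rw [cohomologyMap_kummerι_cupProduct_δ₀_scalar ψ (scalarCocycle ψ) (scalarCocycle_apply ψ), ← ha]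
  have hinv : baseUnitsInvariant K ((a₀⁻¹ : Kˣ) : K) (a₀⁻¹).ne_zero = -a := by
    rw [← hbase, ← baseUnitsInvariant_inv]
    congr 1
    exact Units.val_inv_eq_inv_val a₀
  rw [hinv, map_neg, neg_neg]

end Literature.NumberTheory.GaloisCohomology

end
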